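import Summits.KontsevichZagierPeriods.KontsevichZagierPeriods.Theorems.HurwitzMicroSectorsNormalFormPrincipleLevelOneExistsRep

/-!
# `NormalFormPrinciple` (stmt-KontsevichZagierPeriods-3869), line `SketchIdeator1` —
# the leaf `stub_boxRigidity` in dimension two, level `N`: the representations
# `[(0,1)², P/(1 − (x₀x₁)ᴺ)]` exist

Pure proof file (stub `exists_levelNRep` of the dimension-two, level-`N` layer, lead seat c7;
`--supports` the crux). For every level `N ≥ 1` and every numerator `P ∈ ℚ[x₀, x₁]` the pair
(open unit box of `ℝ²`, `x ↦ P(x)/(1 − (x₀x₁)ᴺ)`) is an integral representation in the sense of the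
tree's Kontsevich–Zagier calculus (`Literature.NumberTheory.Transcendental.KZ.IntegralRep 2`):

* the open box is `ℚ`-semialgebraic (`KZ.isSemialgebraic_box`);
* the integrand is a quotient of `ℚ`-polynomials whose denominator `1 − (x₀x₁)ᴺ` is positive on the
  box (`isSemialgebraicFunOn_aeval_div_aeval`);
* absolute convergence: on the box `0 < 1 − x₀x₁ ≤ 1 − (x₀x₁)ᴺ` (`(x₀x₁)ᴺ ≤ x₀x₁` as
  `0 ≤ x₀x₁ ≤ 1`, `N ≥ 1`), so `|P/(1 − (x₀x₁)ᴺ)| ≤ |P/(1 − x₀x₁)|`, and the level-one integrand is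
  integrable on the box (`LevelOne.integrableOn_aeval_div_one_sub_mul`, resting on Beukers'
  integral for `ζ(2)`); conclude by domination (`MeasureTheory.Integrable.mono`).

Sources: M. Kontsevich, D. Zagier, *Periods* (2001), §1.1; F. Beukers, *A note on the
irrationality of ζ(2) and ζ(3)*, Bull. LMS 11 (1979). No definitions are introduced.
-/

noncomputable section

open MeasureTheory Set
open Literature.NumberTheory.Transcendental Literature.NumberTheory.Transcendental.KZ
open Literature.ModelTheory.ExponentialFields (IsSemialgebraic)
open Summit.KontsevichZagierPeriods.HurwitzMicroSectors.NormalFormPrinciple.PiBox.LevelOne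

namespace Summit.KontsevichZagierPeriods.HurwitzMicroSectors.NormalFormPrinciple.PiBox.LevelN

/-- The level-`N` kernel denominator `1 − (x₀x₁)ᴺ` is positive on the open unit box of `ℝ²`
(`N ≥ 1`). [folklore] -/
theorem one_sub_mul_pow_pos_of_mem_box {N : ℕ} (hN : 1 ≤ N) {x : Fin 2 → ℝ}
    (hx : ∀ i, x i ∈ Set.Ioo (0:ℝ) 1) : 0 < 1 - (x 0 * x 1) ^ N := by
  have h0 := hx 0
  have h1 := hx 1
  exact sub_pos.2 (pow_lt_one₀ (mul_nonneg h0.1.le h1.1.le)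
    (mul_lt_one_of_nonneg_of_lt_one_left h0.1.le h0.2 h1.2.le) (by omega))

/-- On the open unit box of `ℝ²`, `1 − x₀x₁ ≤ 1 − (x₀x₁)ᴺ` for `N ≥ 1` (since `0 ≤ x₀x₁ ≤ 1`).
[folklore] -/
theorem one_sub_mul_le_one_sub_mul_pow {N : ℕ} (hN : 1 ≤ N) {x : Fin 2 → ℝ}
    (hx : ∀ i, x i ∈ Set.Ioo (0:ℝ) 1) : 1 - x 0 * x 1 ≤ 1 - (x 0 * x 1) ^ N := by
  have h0 := hx 0
  have h1 := hx 1
  have h : (x 0 * x 1) ^ N ≤ x 0 * x 1 := pow_le_of_le_one (mul_nonneg h0.1.le h1.1.le)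
    (mul_lt_one_of_nonneg_of_lt_one_left h0.1.le h0.2 h1.2.le).le (by omega)
  linarith

/-- **Semialgebraicity of the level-`N` integrand.** For `N ≥ 1` and `P ∈ ℚ[x₀,x₁]`,
`x ↦ P(x)/(1 − (x₀x₁)ᴺ)` is a `ℚ`-semialgebraic function on the open unit box (a quotient of
`ℚ`-polynomials with non-vanishing denominator). [Kontsevich–Zagier 2001, §1.1] [folklore] -/
theorem isSemialgebraicFunOn_aeval_div_one_sub_mul_pow {N : ℕ} (hN : 1 ≤ N)
    (p : MvPolynomial (Fin 2) ℚ) :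
    IsSemialgebraicFunOn ℚ {x : Fin 2 → ℝ | ∀ i, x i ∈ Set.Ioo (0:ℝ) 1}
      (fun x => (MvPolynomial.aeval x p : ℝ) / (1 - (x 0 * x 1) ^ N)) := by
  refine (isSemialgebraicFunOn_aeval_div_aeval (isSemialgebraic_box 2) p
    (1 - (MvPolynomial.X 0 * MvPolynomial.X 1) ^ N) fun x hx => ?_).congr fun x _ => by simp
  simp only [map_sub, map_one, map_pow, map_mul, MvPolynomial.aeval_X]
  exact (one_sub_mul_pow_pos_of_mem_box hN hx).ne'

/-- **Absolute convergence of the level-`N` integrand.** For `N ≥ 1` and `P ∈ ℚ[x₀,x₁]`,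
`P(x)/(1 − (x₀x₁)ᴺ)` is integrable on the open unit box: it is continuous there and dominated in
absolute value by the level-one integrand `P(x)/(1 − x₀x₁)` (`1 − x₀x₁ ≤ 1 − (x₀x₁)ᴺ`), which is
integrable (Beukers' double integral for `ζ(2)`). [folklore] -/
theorem integrableOn_aeval_div_one_sub_mul_pow {N : ℕ} (hN : 1 ≤ N) (p : MvPolynomial (Fin 2) ℚ) :
    IntegrableOn (fun x : Fin 2 → ℝ => (MvPolynomial.aeval x p : ℝ) / (1 - (x 0 * x 1) ^ N))
      {x | ∀ i, x i ∈ Set.Ioo (0:ℝ) 1} := by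
  have hA : MeasurableSet {x : Fin 2 → ℝ | ∀ i, x i ∈ Set.Ioo (0:ℝ) 1} :=
    Literature.ModelTheory.ExponentialFields.IsSemialgebraic.measurableSet_holds (isSemialgebraic_box 2)
  refine Integrable.mono (integrableOn_aeval_div_one_sub_mul p) ?_ ?_
  · refine ContinuousOn.aestronglyMeasurable ?_ hA
    exact (Literature.ModelTheory.ExponentialFields.continuous_aeval_real p).continuousOn.div₀
      (by fun_prop) fun x hx => (one_sub_mul_pow_pos_of_mem_box hN hx).ne'
  · refine ae_restrict_of_forall_mem hA fun x hx => ?_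
    have h1 := one_sub_mul_pos_of_mem_box hx
    rw [norm_div, norm_div, Real.norm_of_nonneg h1.le,
      Real.norm_of_nonneg (one_sub_mul_pow_pos_of_mem_box hN hx).le]
    exact div_le_div_of_nonneg_left (norm_nonneg _) h1 (one_sub_mul_le_one_sub_mul_pow hN hx)

/-- **V1 (existence of the level-`N` representation).** For every `N ≥ 1` and `P ∈ ℚ[x₀,x₁]` there
is an integral representation of dimension `2` with domain the open unit box `(0,1)²` and integrand
`x ↦ P(x)/(1 − (x₀x₁)ᴺ)` (values: weight-`2` Hurwitz numbers of level `N`).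
[Kontsevich–Zagier 2001, §1.1] [folklore] -/
theorem exists_levelNRep (N : ℕ) (hN : 1 ≤ N) (p : MvPolynomial (Fin 2) ℚ) :
    ∃ R : IntegralRep 2, R.domain = {x | ∀ i, x i ∈ Set.Ioo (0:ℝ) 1} ∧
      R.integrand = fun x => (MvPolynomial.aeval x p : ℝ) / (1 - (x 0 * x 1) ^ N) :=
  ⟨⟨_, _, isSemialgebraic_box 2, isSemialgebraicFunOn_aeval_div_one_sub_mul_pow hN p,
    integrableOn_aeval_div_one_sub_mul_pow hN p⟩, rfl, rfl⟩

end Summit.KontsevichZagierPeriods.HurwitzMicroSectors.NormalFormPrinciple.PiBox.LevelN
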